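import Mathlib
import Summits.Ventures.PercRepro2.Tail2DBlockCalc
import Summits.Ventures.PercRepro2.Tail2DHarrisSP
import Summits.Ventures.PercRepro2.Tail2DFlowOneBlocks
import Summits.Ventures.PercRepro2.Tail2DFlowOnePar
import Summits.Ventures.PercRepro2.Tail2DFlowOneStep01
import Summits.Ventures.PercRepro2.Tail2DFlowOneThreeCounts
import Summits.Ventures.PercRepro2.Tail2DFlowOneAxis
import Summits.Ventures.PercRepro2.Tail2DParFin
import Summits.Ventures.PercRepro2.Tail2DSDomSwap
import Summits.Ventures.PercRepro2.Tail2DRelayColBlocks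

/-!
# The columns `{r = j} ≼ {r = j−1}` of every comb of flow-one factors, arbitrary sizes, by a three-move relay
(seat mine-b, cell pub-perc-repro2; conjectures/MINE-B.md §45.10)

The COLUMN `colAt Y j = {r = j}`.  On `X ∥ Y` with `X` flow-one, `colAt (X ∥ Y) (i+1) = R × colAt Y i ⊔ col × colAt Y (i+1)`.
The RELAY: `R × colAt Y i → R × colAt Y (i−1)` (the column step of `Y`), `R × colAt Y i → col × colAt Y i`
(`R ≼ col`), `col × colAt Y (i+1) → col × colAt Y i` (the column step of `Y`) — three forced weights, non-negative
iff the column counts of `Y` are log-concave at `i`: `C_{i−1} C_{i+1} ≤ C_i²` (`colDom_par_step`; at `i = 0` two moves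
and no condition).  The column counts of `X ∥ Y` are `C'_j = a C_{j−1} + (a+c) C_j` — a two-term convolution — so
log-concavity with no internal zeros is inherited (`colLC_par`, Hoggar's step `two_term_lc`).  Hence, by induction
along a comb: **`Unif{r = j} ≼ Unif{r = j−1}` for every `j ≥ 1` on every parallel composition of flow-one factors
with red crossings and ARBITRARY sizes** (`colDom_parFin`) — the «relax a uniformly random red» step of §43.1, proved
there for identical factors only, now with a closed form for general sizes; by the colour swap the rows
`{b = c} ≼ {b = c+1}` follow (`rowDom_parFin`).
-/

namespace Summit.Ventures.PercRepro2.Tail2D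

open V2Closure Finset


section Step

variable (X Y : V2Closure.SP)

/-- **the column relay at `j + 2`**: from the column steps `C_{j+1} ≼ C_j` and `C_{j+2} ≼ C_{j+1}` of `Y` and the
log-concavity `C_j C_{j+2} ≤ C_{j+1}²`, the column step `{r = j+2} ≼ {r = j+1}` of `X ∥ Y` -/
theorem colDom_par_step (hX : FlowOne X) (ha : 0 < (rSet X).card) (j : ℕ)
    (hC : 0 < colCount Y (j + 1)) (h1 : BlockDom Y (colAt Y (j + 1)) (colAt Y j))
    (h2 : BlockDom Y (colAt Y (j + 2)) (colAt Y (j + 1)))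
    (hLC : colCount Y j * colCount Y (j + 2) ≤ colCount Y (j + 1) * colCount Y (j + 1)) :
    BlockDom (V2Closure.SP.par X Y) (colAt (V2Closure.SP.par X Y) (j + 2)) (colAt (V2Closure.SP.par X Y) (j + 1)) := by
  obtain ⟨-, hCol, -, hn, hRne, -, hColne, -⟩ := counts X hX ha
  have hE := colCount_par_succ Y X hX (j + 1)
  have hE' := colCount_par_succ Y X hX j
  have haq : (0 : ℚ) < (rSet X).card := by exact_mod_cast ha
  have hnaq : (0 : ℚ) < ((Fintype.card X.Conf - (rSet X).card : ℕ) : ℚ) := by exact_mod_cast Nat.sub_pos_of_lt hn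
  have hCq : (0 : ℚ) < colCount Y (j + 1) := by exact_mod_cast hC
  have hC0q : (0 : ℚ) ≤ colCount Y j := by positivity
  have hC2q : (0 : ℚ) ≤ colCount Y (j + 2) := by positivity
  have hLCq : (colCount Y j : ℚ) * colCount Y (j + 2) ≤ colCount Y (j + 1) * colCount Y (j + 1) := by
    exact_mod_cast hLC
  have hEq : (colCount (V2Closure.SP.par X Y) (j + 2) : ℚ)
      = (rSet X).card * colCount Y (j + 1) + ((Fintype.card X.Conf - (rSet X).card : ℕ) : ℚ) * colCount Y (j + 2) := by
    rw [hE]; push_cast; ring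
  have hE'q : (colCount (V2Closure.SP.par X Y) (j + 1) : ℚ)
      = (rSet X).card * colCount Y j + ((Fintype.card X.Conf - (rSet X).card : ℕ) : ℚ) * colCount Y (j + 1) := by
    rw [hE']; push_cast; ring
  have hEpos : (0 : ℚ) < colCount (V2Closure.SP.par X Y) (j + 2) := by rw [hEq]; positivity
  have hE'pos : (0 : ℚ) < colCount (V2Closure.SP.par X Y) (j + 1) := by rw [hE'q]; positivity
  have hE0 : (colCount (V2Closure.SP.par X Y) (j + 2) : ℚ) ≠ 0 := ne_of_gt hEpos
  have hE'0 : (colCount (V2Closure.SP.par X Y) (j + 1) : ℚ) ≠ 0 := ne_of_gt hE'pos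
  have ha0 : ((rSet X).card : ℚ) ≠ 0 := ne_of_gt haq
  have hna0 : ((Fintype.card X.Conf - (rSet X).card : ℕ) : ℚ) ≠ 0 := ne_of_gt hnaq
  have hC10 : (colCount Y (j + 1) : ℚ) ≠ 0 := ne_of_gt hCq
  -- the relax weight is non-negative by the log-concavity
  obtain ⟨w2, hw2, hw2nn⟩ : ∃ w2 : ℚ,
      w2 = ((rSet X).card : ℚ) * ((colCount Y (j + 1) : ℚ) / colCount (V2Closure.SP.par X Y) (j + 2)
        - (colCount Y j : ℚ) / colCount (V2Closure.SP.par X Y) (j + 1)) ∧ 0 ≤ w2 := by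
    refine ⟨_, rfl, ?_⟩
    refine mul_nonneg haq.le ?_
    rw [sub_nonneg, div_le_div_iff₀ hE'pos hEpos, hEq, hE'q]
    nlinarith
  refine blockDom_par_of_certificate X Y
      ![rSet X, rSet X, colSet X] ![rSet X, colSet X, colSet X]
      ![colAt Y (j + 1), colAt Y (j + 1), colAt Y (j + 2)] ![colAt Y j, colAt Y (j + 1), colAt Y (j + 1)]
      ![((rSet X).card : ℚ) * ((colCount Y j : ℚ) / colCount (V2Closure.SP.par X Y) (j + 1)), w2,
        (((Fintype.card X.Conf - (rSet X).card : ℕ) : ℚ) * colCount Y (j + 2)) / colCount (V2Closure.SP.par X Y) (j + 2)]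
      ?_ ?_ ?_ ?_ _ _ ?_ ?_
  · intro k; fin_cases k
    · show (0 : ℚ) ≤ ((rSet X).card : ℚ) * ((colCount Y j : ℚ) / colCount (V2Closure.SP.par X Y) (j + 1)); positivity
    · exact hw2nn
    · show (0 : ℚ) ≤ (((Fintype.card X.Conf - (rSet X).card : ℕ) : ℚ) * colCount Y (j + 2))
        / colCount (V2Closure.SP.par X Y) (j + 2)
      positivity
  · intro k; fin_cases k
    · show BlockDom X (rSet X) (rSet X); exact blockDom_refl X _
    · show BlockDom X (rSet X) (colSet X); exact dom_r_col X
    · show BlockDom X (colSet X) (colSet X); exact blockDom_refl X _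
  · intro k; fin_cases k
    · show BlockDom Y (colAt Y (j + 1)) (colAt Y j); exact h1
    · show BlockDom Y (colAt Y (j + 1)) (colAt Y (j + 1)); exact blockDom_refl Y _
    · show BlockDom Y (colAt Y (j + 2)) (colAt Y (j + 1)); exact h2
  · intro k hk _
    have hCne : (colAt Y (j + 1)).Nonempty := by rw [← Finset.card_pos]; exact hC
    match k with
    | 0 =>
      show (rSet X ×ˢ colAt Y j).Nonempty
      have hk0 : (0 : ℚ) < ((rSet X).card : ℚ) * ((colCount Y j : ℚ) / colCount (V2Closure.SP.par X Y) (j + 1)) := hk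
      refine Finset.nonempty_product.2 ⟨hRne, ?_⟩
      rw [← Finset.card_pos]
      by_contra h0
      have h0' : colCount Y j = 0 := by unfold colCount; omega
      rw [h0'] at hk0; simp at hk0
    | 1 =>
      show (colSet X ×ˢ colAt Y (j + 1)).Nonempty
      exact Finset.nonempty_product.2 ⟨hColne, hCne⟩
    | 2 =>
      show (colSet X ×ˢ colAt Y (j + 1)).Nonempty
      exact Finset.nonempty_product.2 ⟨hColne, hCne⟩
  · rintro ⟨x, y⟩
    simp only [Fin.sum_univ_succ, Fin.sum_univ_zero, Matrix.cons_val_zero, Matrix.cons_val_succ, unifDens_par_prod,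
      unifDens_colAt, rLab_par_pair, mem_rSet, mem_colSet, mem_colAt, hCol, card_colAt]
    rcases flowOne_cases X hX x with hx | hx | hx
    · by_cases h : Y.rLab y = j + 1
      · simp [hx.1, h, (by omega : 1 + (j + 1) = j + 2)]
        rw [hw2]; field_simp; ring
      · have h' : ¬ (1 + Y.rLab y = j + 2) := by omega
        simp [hx.1, h, h']
    · by_cases h : Y.rLab y = j + 2
      · have hC2 : (colCount Y (j + 2) : ℚ) ≠ 0 := by
          have : 0 < colCount Y (j + 2) := by
            unfold colCount; exact Finset.card_pos.2 ⟨y, (mem_colAt Y (j + 2) y).2 h⟩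
          exact_mod_cast ne_of_gt this
        simp [hx.1, h]
        field_simp
      · simp [hx.1, h]
    · by_cases h : Y.rLab y = j + 2
      · have hC2 : (colCount Y (j + 2) : ℚ) ≠ 0 := by
          have : 0 < colCount Y (j + 2) := by
            unfold colCount; exact Finset.card_pos.2 ⟨y, (mem_colAt Y (j + 2) y).2 h⟩
          exact_mod_cast ne_of_gt this
        simp [hx.1, h]
        field_simp
      · simp [hx.1, h]
  · rintro ⟨x, y⟩
    simp only [Fin.sum_univ_succ, Fin.sum_univ_zero, Matrix.cons_val_zero, Matrix.cons_val_succ, unifDens_par_prod,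
      unifDens_colAt, rLab_par_pair, mem_rSet, mem_colSet, mem_colAt, hCol, card_colAt]
    rcases flowOne_cases X hX x with hx | hx | hx
    · by_cases h : Y.rLab y = j
      · have hC1 : (colCount Y j : ℚ) ≠ 0 := by
          have : 0 < colCount Y j := by
            unfold colCount; exact Finset.card_pos.2 ⟨y, (mem_colAt Y j y).2 h⟩
          exact_mod_cast ne_of_gt this
        simp [hx.1, h, (by omega : 1 + j = j + 1)]
        field_simp
      · have h' : ¬ (1 + Y.rLab y = j + 1) := by omega
        simp [hx.1, h, h']
    · by_cases h : Y.rLab y = j + 1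
      · simp [hx.1, h]
        rw [hw2, hEq, hE'q]; field_simp; ring
      · simp [hx.1, h]
    · by_cases h : Y.rLab y = j + 1
      · simp [hx.1, h]
        rw [hw2, hEq, hE'q]; field_simp; ring
      · simp [hx.1, h]

/-- **the column relay at level `1`**: from `C_1 ≼ C_0` of `Y`, the column step `{r = 1} ≼ {r = 0}` of `X ∥ Y` -/
theorem colDom_par_one (hX : FlowOne X) (ha : 0 < (rSet X).card) (hC0 : 0 < colCount Y 0)
    (h2 : BlockDom Y (colAt Y 1) (colAt Y 0)) :
    BlockDom (V2Closure.SP.par X Y) (colAt (V2Closure.SP.par X Y) 1) (colAt (V2Closure.SP.par X Y) 0) := by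
  obtain ⟨-, hCol, -, hn, hRne, -, hColne, -⟩ := counts X hX ha
  have hE := colCount_par_succ Y X hX 0
  have hE' := colCount_par_zero Y X hX
  have haq : (0 : ℚ) < (rSet X).card := by exact_mod_cast ha
  have hnaq : (0 : ℚ) < ((Fintype.card X.Conf - (rSet X).card : ℕ) : ℚ) := by exact_mod_cast Nat.sub_pos_of_lt hn
  have hC0q : (0 : ℚ) < colCount Y 0 := by exact_mod_cast hC0
  have hC1q : (0 : ℚ) ≤ colCount Y 1 := by positivity
  have hEq : (colCount (V2Closure.SP.par X Y) 1 : ℚ)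
      = (rSet X).card * colCount Y 0 + ((Fintype.card X.Conf - (rSet X).card : ℕ) : ℚ) * colCount Y 1 := by
    rw [hE]; push_cast; ring
  have hE'q : (colCount (V2Closure.SP.par X Y) 0 : ℚ) = ((Fintype.card X.Conf - (rSet X).card : ℕ) : ℚ) * colCount Y 0 := by
    rw [hE']; push_cast; ring
  have hEpos : (0 : ℚ) < colCount (V2Closure.SP.par X Y) 1 := by rw [hEq]; positivity
  have hE'pos : (0 : ℚ) < colCount (V2Closure.SP.par X Y) 0 := by rw [hE'q]; positivity
  have hE0 : (colCount (V2Closure.SP.par X Y) 1 : ℚ) ≠ 0 := ne_of_gt hEpos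
  have hE'0 : (colCount (V2Closure.SP.par X Y) 0 : ℚ) ≠ 0 := ne_of_gt hE'pos
  have hna0 : ((Fintype.card X.Conf - (rSet X).card : ℕ) : ℚ) ≠ 0 := ne_of_gt hnaq
  have hC00 : (colCount Y 0 : ℚ) ≠ 0 := ne_of_gt hC0q
  have hC0ne : (colAt Y 0).Nonempty := by rw [← Finset.card_pos]; exact hC0
  refine blockDom_par_of_certificate X Y
      ![rSet X, colSet X] ![colSet X, colSet X] ![colAt Y 0, colAt Y 1] ![colAt Y 0, colAt Y 0]
      ![((rSet X).card : ℚ) * colCount Y 0 / colCount (V2Closure.SP.par X Y) 1,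
        (((Fintype.card X.Conf - (rSet X).card : ℕ) : ℚ) * colCount Y 1) / colCount (V2Closure.SP.par X Y) 1]
      ?_ ?_ ?_ ?_ _ _ ?_ ?_
  · intro k; fin_cases k
    · show (0 : ℚ) ≤ ((rSet X).card : ℚ) * colCount Y 0 / colCount (V2Closure.SP.par X Y) 1; positivity
    · show (0 : ℚ) ≤ (((Fintype.card X.Conf - (rSet X).card : ℕ) : ℚ) * colCount Y 1) / colCount (V2Closure.SP.par X Y) 1
      positivity
  · intro k; fin_cases k
    · show BlockDom X (rSet X) (colSet X); exact dom_r_col X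
    · show BlockDom X (colSet X) (colSet X); exact blockDom_refl X _
  · intro k; fin_cases k
    · show BlockDom Y (colAt Y 0) (colAt Y 0); exact blockDom_refl Y _
    · show BlockDom Y (colAt Y 1) (colAt Y 0); exact h2
  · intro k _ _
    match k with
    | 0 => show (colSet X ×ˢ colAt Y 0).Nonempty; exact Finset.nonempty_product.2 ⟨hColne, hC0ne⟩
    | 1 => show (colSet X ×ˢ colAt Y 0).Nonempty; exact Finset.nonempty_product.2 ⟨hColne, hC0ne⟩
  · rintro ⟨x, y⟩
    simp only [Fin.sum_univ_succ, Fin.sum_univ_zero, Matrix.cons_val_zero, Matrix.cons_val_succ, unifDens_par_prod,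
      unifDens_colAt, rLab_par_pair, mem_rSet, mem_colSet, mem_colAt, hCol, card_colAt]
    rcases flowOne_cases X hX x with hx | hx | hx
    · by_cases h : Y.rLab y = 0
      · simp [hx.1, h]
        field_simp
      · simp [hx.1, h]
    · by_cases h : Y.rLab y = 1
      · have hC1 : (colCount Y 1 : ℚ) ≠ 0 := by
          have : 0 < colCount Y 1 := by
            unfold colCount; exact Finset.card_pos.2 ⟨y, (mem_colAt Y 1 y).2 h⟩
          exact_mod_cast ne_of_gt this
        simp [hx.1, h]
        field_simp
      · simp [hx.1, h]
    · by_cases h : Y.rLab y = 1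
      · have hC1 : (colCount Y 1 : ℚ) ≠ 0 := by
          have : 0 < colCount Y 1 := by
            unfold colCount; exact Finset.card_pos.2 ⟨y, (mem_colAt Y 1 y).2 h⟩
          exact_mod_cast ne_of_gt this
        simp [hx.1, h]
        field_simp
      · simp [hx.1, h]
  · rintro ⟨x, y⟩
    simp only [Fin.sum_univ_succ, Fin.sum_univ_zero, Matrix.cons_val_zero, Matrix.cons_val_succ, unifDens_par_prod,
      unifDens_colAt, rLab_par_pair, mem_colSet, mem_colAt, hCol, card_colAt]
    rcases flowOne_cases X hX x with hx | hx | hx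
    · simp [hx.1]
    · by_cases h : Y.rLab y = 0
      · simp [hx.1, h]
        rw [hEq, hE'q]; field_simp
      · simp [hx.1, h]
    · by_cases h : Y.rLab y = 0
      · simp [hx.1, h]
        rw [hEq, hE'q]; field_simp
      · simp [hx.1, h]

end Step

section Comb

/-- a block with no configuration is dominated by everything -/
theorem blockDom_of_card_zero (s : V2Closure.SP) {A A' : Finset s.Conf} (h : A.card = 0) : BlockDom s A A' := by
  intro f _
  rw [Finset.card_eq_zero] at h
  subst h
  simp [blockSum]

/-- log-concave column counts with no internal zeros: positive up to the number of factors, zero beyond -/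
def ColLC (Y : V2Closure.SP) (k : ℕ) : Prop :=
  (∀ j, j ≤ k → 0 < colCount Y j) ∧ (∀ j, k < j → colCount Y j = 0) ∧
  (∀ j, colCount Y j * colCount Y (j + 2) ≤ colCount Y (j + 1) * colCount Y (j + 1))

/-- the cross inequality `C_j C_{j+3} ≤ C_{j+1} C_{j+2}` of a log-concave sequence without internal zeros -/
theorem colLC_cross {Y : V2Closure.SP} {k : ℕ} (h : ColLC Y k) (j : ℕ) :
    colCount Y j * colCount Y (j + 3) ≤ colCount Y (j + 1) * colCount Y (j + 2) := by
  obtain ⟨hpos, hzero, hLC⟩ := h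
  by_cases hk : k < j + 3
  · rw [hzero (j + 3) hk]; simp
  · have h1 : 0 < colCount Y (j + 1) := hpos _ (by omega)
    have h2 : 0 < colCount Y (j + 2) := hpos _ (by omega)
    have hpos' : 0 < colCount Y (j + 1) * colCount Y (j + 2) := Nat.mul_pos h1 h2
    have key : (colCount Y j * colCount Y (j + 3)) * (colCount Y (j + 1) * colCount Y (j + 2))
        ≤ (colCount Y (j + 1) * colCount Y (j + 2)) * (colCount Y (j + 1) * colCount Y (j + 2)) := by
      calc (colCount Y j * colCount Y (j + 3)) * (colCount Y (j + 1) * colCount Y (j + 2))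
          = (colCount Y j * colCount Y (j + 2)) * (colCount Y (j + 1) * colCount Y (j + 3)) := by ring
        _ ≤ (colCount Y (j + 1) * colCount Y (j + 1)) * (colCount Y (j + 2) * colCount Y (j + 2)) :=
          Nat.mul_le_mul (hLC j) (hLC (j + 1))
        _ = (colCount Y (j + 1) * colCount Y (j + 2)) * (colCount Y (j + 1) * colCount Y (j + 2)) := by ring
    exact Nat.le_of_mul_le_mul_right key hpos'

/-- **the column log-concavity is inherited by `X ∥ Y`** (the two-term convolution `C'_j = a C_{j−1} + (n−a) C_j`) -/
theorem colLC_par (X Y : V2Closure.SP) (hX : FlowOne X) (ha : 0 < (rSet X).card) {k : ℕ} (h : ColLC Y k) :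
    ColLC (V2Closure.SP.par X Y) (k + 1) := by
  obtain ⟨hpos, hzero, hLC⟩ := h
  have hn := card_rSet_lt X hX ha
  have hb : 0 < Fintype.card X.Conf - (rSet X).card := Nat.sub_pos_of_lt hn
  refine ⟨?_, ?_, ?_⟩
  · intro j hj
    rcases j with _ | j
    · rw [colCount_par_zero Y X hX]; exact Nat.mul_pos hb (hpos 0 (by omega))
    · rw [colCount_par_succ Y X hX j]
      have := hpos j (by omega)
      positivity
  · intro j hj
    rcases j with _ | j
    · omega
    · rw [colCount_par_succ Y X hX j, hzero j (by omega), hzero (j + 1) (by omega)]; ring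
  · intro j
    rcases j with _ | j
    · rw [colCount_par_zero Y X hX, colCount_par_succ Y X hX 0, colCount_par_succ Y X hX 1]
      have := hLC 0
      nlinarith [Nat.mul_le_mul_left ((Fintype.card X.Conf - (rSet X).card) * (Fintype.card X.Conf - (rSet X).card)) this,
        Nat.zero_le ((rSet X).card * (rSet X).card * (colCount Y 0 * colCount Y 0)),
        Nat.zero_le ((rSet X).card * (Fintype.card X.Conf - (rSet X).card) * (colCount Y 0 * colCount Y 1))]
    · have e1 : j + 1 + 2 = j + 3 := rfl
      have e2 : j + 1 + 1 = j + 2 := rfl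
      rw [e1, e2, colCount_par_succ Y X hX j, colCount_par_succ Y X hX (j + 2), colCount_par_succ Y X hX (j + 1)]
      have h1 := hLC j
      have h2 := hLC (j + 1)
      rw [e1, e2] at h2
      have hx := colLC_cross ⟨hpos, hzero, hLC⟩ j
      have key := two_term_lc (colCount Y j) (colCount Y (j + 1)) (colCount Y (j + 2)) (colCount Y (j + 3))
        (Fintype.card X.Conf - (rSet X).card) ((rSet X).card) h1 h2 hx
      nlinarith [key]

/-- the columns of the absent edge: one configuration with `r = 0` -/
theorem colLC_absent : ColLC V2Closure.SP.absent 0 := by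
  have h0 : ∀ j, colCount V2Closure.SP.absent j = if j = 0 then 1 else 0 := by
    intro j
    unfold colCount colAt
    by_cases hj : j = 0
    · subst hj; rfl
    · rw [if_neg hj, Finset.card_eq_zero, Finset.eq_empty_iff_forall_notMem]
      intro x hx
      rw [Finset.mem_filter] at hx
      have : V2Closure.SP.absent.rLab x = 0 := rfl
      omega
  refine ⟨?_, ?_, ?_⟩
  · intro j hj; rw [h0, if_pos (by omega)]; exact Nat.one_pos
  · intro j hj; rw [h0, if_neg (by omega)]
  · intro j; rw [h0, h0, h0]; split_ifs <;> omega

/-- the column log-concavity holds along every comb of flow-one factors with red crossings -/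
theorem colLC_parFin : ∀ (k : ℕ) (X : Fin k → V2Closure.SP), (∀ i, FlowOne (X i)) → (∀ i, 0 < (rSet (X i)).card) →
    ColLC (parFin k X) k
  | 0, _, _, _ => colLC_absent
  | k + 1, X, hX, hR => by
      show ColLC (V2Closure.SP.par (X 0) (parFin k (Fin.tail X))) (k + 1)
      exact colLC_par _ _ (hX 0) (hR 0) (colLC_parFin k (Fin.tail X) (fun i => hX i.succ) (fun i => hR i.succ))

/-- **the column steps `{r = j+1} ≼ {r = j}` on every parallel composition of flow-one factors with red
crossings, arbitrary sizes**, for every `j` -/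
theorem colDom_parFin : ∀ (k : ℕ) (X : Fin k → V2Closure.SP), (∀ i, FlowOne (X i)) → (∀ i, 0 < (rSet (X i)).card) →
    ∀ j, BlockDom (parFin k X) (colAt (parFin k X) (j + 1)) (colAt (parFin k X) j)
  | 0, _, _, _, j => by
      apply blockDom_of_card_zero
      have := (colLC_absent).2.1 (j + 1) (by omega)
      exact this
  | k + 1, X, hX, hR, j => by
      show BlockDom (V2Closure.SP.par (X 0) (parFin k (Fin.tail X))) _ _
      have ih := colDom_parFin k (Fin.tail X) (fun i => hX i.succ) (fun i => hR i.succ)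
      obtain ⟨hpos, hzero, hLC⟩ := colLC_parFin k (Fin.tail X) (fun i => hX i.succ) (fun i => hR i.succ)
      rcases j with _ | j
      · exact colDom_par_one _ _ (hX 0) (hR 0) (hpos 0 (Nat.zero_le _)) (ih 0)
      · by_cases hk : j + 1 ≤ k
        · exact colDom_par_step _ _ (hX 0) (hR 0) j (hpos (j + 1) hk) (ih j) (ih (j + 1)) (hLC j)
        · apply blockDom_of_card_zero
          show colCount (V2Closure.SP.par (X 0) (parFin k (Fin.tail X))) (j + 2) = 0
          rw [colCount_par_succ _ _ (hX 0) (j + 1), hzero (j + 1) (by omega), hzero (j + 2) (by omega)]; ring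

/-- the colour swap carries a column onto a row -/
theorem image_swap_colAt (s : V2Closure.SP) (j : ℕ) : (colAt s j).image (swapConf s) = rowSet s j := by
  ext x
  rw [mem_image_swap, mem_colAt, rLab_swapConf]
  simp [rowSet]

/-- **the row steps `{b = c} ≼ {b = c+1}` on every parallel composition of flow-one factors with red crossings,
arbitrary sizes** — the normalized matching of the rows of §42.1 on combs, by the colour swap -/
theorem rowDom_parFin (k : ℕ) (X : Fin k → V2Closure.SP) (hX : ∀ i, FlowOne (X i)) (hR : ∀ i, 0 < (rSet (X i)).card)
    (c : ℕ) : BlockDom (parFin k X) (rowSet (parFin k X) c) (rowSet (parFin k X) (c + 1)) := by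
  have h := blockDom_swap (parFin k X) (colDom_parFin k X hX hR c)
  rwa [image_swap_colAt, image_swap_colAt] at h

end Comb

end Summit.Ventures.PercRepro2.Tail2D
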